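import Summits.ABC.ABC.Theses.DefiniteXi
import Literature.NumberTheory.EllipticCurves.EichlerBasisTheoremOfTraceIdentity
import Literature.NumberTheory.EllipticCurves.TakahashiRankOneOfEichlerSelberg
import Literature.NumberTheory.EllipticCurves.EichlerSelbergTraceWeightTwoSquarefree
import Literature.NumberTheory.EllipticCurves.TakahashiDegreeFormula
import HarnessLib

/-!
# `stub_takahashi` · ideator k3 · gen 21 — FAMILY 3 (probe the extremes):
# perturbation of the PROVED half (rank one) from the square-free neighbour to the coprime regime

Companion of `Cruxes/DefiniteRTControlPrime/STUB-IDEAS-stub_takahashi-3.md` (gen 21).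
Crux `stmt-ABC-11338` = `DefiniteXi.DefiniteRTControlPrime`; registered stub (fixed, untouched):
`theorem stub_takahashi : takahashi2001_thm_2_3_of_coprime`.

The stub splits (k1-g15/k2-g13, `Lines/TakahashiLeaves.lean`) into `H_R` (Brandt eigen-lattice rank one
at coprime level `(M, r)`) and `H_D` (character-group dictionary at `r ∥ N`).  The square-free
neighbour of `H_R` is a tree THEOREM (`takahashi2001_brandtEigenLattice_rank_one_holds`, via Popa's
Eichler–Selberg identities).  This file records, regime by regime (`good : ℕ → Prop` on the cofactor
`M`), exactly what that proof needs under the perturbation `Squarefree M ↦ M.Coprime r`: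
the descent `finrank_eigenLattice_eq_one_of_traceIdentity` is ALREADY general in `M`, so
`H_R` at regime `good` follows from Pizer's trace identity (2.8) at regime `good` (H21.3), and the
identity holds in-tree at `good = Squarefree` (H21.4).  What is missing at `good = ⊤` is named in
H21.5/H21.6: Eichler's Brandt trace formula for Eichler orders of NON-square-free level `M`
(tree: `XiSetup.trace_matrix_eq_sumInvWeight_add` carries `hsq : Squarefree M`) and the
Eichler–Selberg identity at non-square-free level (tree: `cuspidalHeckeTrace_eq_geometricSide`
carries `Squarefree N`; the all-level statement is the named fact `HeckeTraceFormulaGL2Level N 1 2`).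
No `sorry`; everything below elaborates.
-/

set_option linter.dupNamespace false

noncomputable section

namespace Summit.ABC.ABC.Cruxes.DefiniteRTControlPrime.StubIdeas3G21

open Literature.NumberTheory.EllipticCurves Literature.NumberTheory.EllipticCurves.ModularForms
open Literature.NumberTheory.Automorphic Literature.NumberTheory.Automorphic.Brandt
open Literature.NumberTheory.Automorphic.HeckeTraceFormulaGL2Level
open Literature.NumberTheory.EllipticCurves.BrandtJL
open ArithmeticFunction
open scoped ArithmeticFunction.sigma

/-- H21.1 · Pizer's trace identity (2.8) at level `(M, r)`, `r` prime, `r ∤ M`, for the cofactors `M`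
with `good M`:  `Tr(T_n | S₂(Γ₀(Mr))) = Tr B(n) − σ₁(n) + 2 Tr(T_n | S₂(Γ₀(M)))`, `(n, Mr) = 1`.
[cite: Pizer1980, Thm. 2.25 (2.8); Eichler1955, (5); HijikataPizerShemanske1989 (arbitrary `M`)] -/
def TraceIdentityAt (good : ℕ → Prop) : Prop :=
  ∀ (M r : ℕ) [NeZero M] [NeZero (M * r)], good M → r.Prime → ¬ r ∣ M →
    ∀ (S : XiSetup M r) [Fintype (ClassSet S.O)] (n : ℕ), 0 < n → n.Coprime (M * r) →
      cuspidalHeckeTrace (M * r) 2 1 n =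
        (((Brandt.matrix S.O n).trace : ℤ) : ℂ) - ((σ 1 n : ℕ) : ℂ) + 2 * cuspidalHeckeTrace M 2 1 n

/-- H21.2 · `H_R` restricted to cofactors with `good M`; at `good = ⊤` this is VERBATIM the statement of
`stub_brandtRankOne` of `Lines/TakahashiLeaves.lean` (H21.2′). -/
def BrandtRankOneAt (good : ℕ → Prop) : Prop :=
  ∀ (W : WeierstrassCurve ℚ) [W.IsElliptic] (M r : ℕ) [NeZero (M * r)],
    good M → r.Prime → M.Coprime r → W.conductorNorm ℤ = M * r →
    ∀ (_P : ModularParametrizationData W (M * r)) (S : Brandt.XiSetup M r)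
      [Fintype (Brandt.ClassSet S.O)],
      Module.finrank ℤ
        (Brandt.eigenLattice (M * r) (Brandt.matrix S.O) (fun n => W.LFunction n)) = 1

/-- The statement of `stub_brandtRankOne` (`Lines/TakahashiLeaves.lean`, k2-g13), restated verbatim. -/
def BrandtRankOneCoprime : Prop :=
  ∀ (W : WeierstrassCurve ℚ) [W.IsElliptic] (M r : ℕ) [NeZero (M * r)],
    r.Prime → M.Coprime r → W.conductorNorm ℤ = M * r →
    ∀ (_P : ModularParametrizationData W (M * r)) (S : Brandt.XiSetup M r)
      [Fintype (Brandt.ClassSet S.O)],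
      Module.finrank ℤ
        (Brandt.eigenLattice (M * r) (Brandt.matrix S.O) (fun n => W.LFunction n)) = 1

/-- H21.2′ (PROVED): the full regime is the candidate line's stub. -/
theorem brandtRankOneCoprime_iff_at_true : BrandtRankOneCoprime ↔ BrandtRankOneAt fun _ => True := by
  constructor
  · intro h W _ M r _ _ hr hcop hN P S _
    exact h W M r hr hcop hN P S
  · intro h W _ M r _ hr hcop hN P S _
    exact h W M r trivial hr hcop hN P S

theorem BrandtRankOneAt.mono {A B : ℕ → Prop} (hAB : ∀ M, A M → B M) (h : BrandtRankOneAt B) :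
    BrandtRankOneAt A :=
  fun W _ M r _ hA hr hcop hN P S _ => h W M r (hAB M hA) hr hcop hN P S

/-- H21.3 (PROVED, the perturbation-stable step): in ANY regime the trace identity gives rank one —
the tree's descent `finrank_eigenLattice_eq_one_of_traceIdentity` never uses `Squarefree M`. -/
theorem brandtRankOneAt_of_traceIdentityAt {good : ℕ → Prop} (h : TraceIdentityAt good) :
    BrandtRankOneAt good := by
  intro W _ M r _ hM hr hcop hN P S _
  haveI : NeZero M := ⟨left_ne_zero_of_mul (NeZero.ne (M * r))⟩
  have hrM : ¬ r ∣ M := fun hdvd => hr.one_lt.ne' (Nat.Coprime.eq_one_of_dvd hcop.symm hdvd)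
  exact finrank_eigenLattice_eq_one_of_traceIdentity S
    (fun n hn0 hn => h M r hM hr hrM S n hn0 hn) W hr.one_lt P

/-- H21.4 (PROVED, the neighbour): the trace identity at square-free cofactors is a tree theorem
(Eichler's Brandt trace formula with symbolic mass term + Popa's Eichler–Selberg identities). -/
theorem traceIdentityAt_squarefree : TraceIdentityAt fun M => Squarefree M := by
  intro M r _ _ hsq hr hrM S _ n hn0 hn
  haveI : NeZero r := ⟨hr.ne_zero⟩
  have hsqN : Squarefree (M * r) :=
    (Nat.squarefree_mul (Nat.Coprime.symm ((Nat.Prime.coprime_iff_not_dvd hr).mpr hrM))).mpr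
      ⟨hsq, hr.squarefree⟩
  exact traceIdentity_of_cuspidalHeckeTrace_eq hr hrM hsq S
    (fun n hn0 hn => cuspidalHeckeTrace_eq_geometricSide hsqN hn0 hn)
    (fun n hn0 hn => cuspidalHeckeTrace_eq_geometricSide hsq hn0
      (Nat.Coprime.coprime_dvd_right (dvd_mul_right M r) hn)) n hn0 hn

/-- H21.4′ (PROVED): hence `H_R` on the square-free regime — the proved neighbouring case of the stub's
rank-one half, by a route independent of `takahashi2001_brandtEigenLattice_rank_one_holds`. -/
theorem brandtRankOneAt_squarefree : BrandtRankOneAt fun M => Squarefree M :=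
  brandtRankOneAt_of_traceIdentityAt traceIdentityAt_squarefree

/-- H21.5 · the JL / Eichler-basis-problem leaf at coprime level in its weakest usable form: the
`a(W)`-eigenpacket (away from `Mr`) in `ℂ^{Cls O}` is a LINE.  Jacquet–Langlands + Casselman's local
newform theory give multiplicity `σ₀(M/M')` for a form of conductor `rM'`, hence `1` for the newform
of `W` (conductor exactly `Mr`); Hijikata–Pizer–Shemanske prove it for Eichler (and more general)
orders of arbitrary level.  [cite: HijikataPizerShemanske1989, Thm. 7.12; Pizer1980, Thm. 2.28] -/
def BrandtEigenLineAt (good : ℕ → Prop) : Prop :=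
  ∀ (W : WeierstrassCurve ℚ) [W.IsElliptic] (M r : ℕ) [NeZero (M * r)],
    good M → r.Prime → M.Coprime r → W.conductorNorm ℤ = M * r →
    ∀ (_P : ModularParametrizationData W (M * r)) (S : Brandt.XiSetup M r)
      [Fintype (Brandt.ClassSet S.O)],
      Module.finrank ℂ
        (Brandt.eigenSpace ℂ (M * r) (Brandt.matrix S.O) (fun n => W.LFunction n)) = 1

/-- H21.5′ (PROVED): the eigen-line statement gives `H_R` in the same regime (saturated-lattice
descent `finrank_eigenLattice_eq_one_of_finrank_eigenSpace_eq_one`, general in `M`). -/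
theorem brandtRankOneAt_of_eigenLineAt {good : ℕ → Prop} (h : BrandtEigenLineAt good) :
    BrandtRankOneAt good :=
  fun W _ M r _ hM hr hcop hN P S _ =>
    finrank_eigenLattice_eq_one_of_finrank_eigenSpace_eq_one (h W M r hM hr hcop hN P S)

/-- H21.6 · the tree-internal road to the full regime: the all-level Eichler–Selberg named fact
(`HeckeTraceFormulaGL2Level N 1 2`, PROVED in-tree at square-free `N` only) reduces `TraceIdentityAt ⊤`
to Eichler's trace formula for Brandt matrices of Eichler orders of ARBITRARY level `M` in
Eichler–Selberg organisation — the one `Squarefree M` hypothesis of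
`XiSetup.trace_matrix_eq_sumInvWeight_add` is the whole perturbation gap on the Brandt side.
Typed here as the implication to establish (its proof = that generalisation; NOT claimed). -/
def TraceIdentityOfTraceFormulaCoprime : Prop :=
  (∀ (N : ℕ) [NeZero N], HeckeTraceFormulaGL2Level N 1 2) → TraceIdentityAt fun _ => True

/-- H21.6′ (PROVED bookkeeping): granting H21.6 and the all-level Eichler–Selberg fact, the candidate
line's `stub_brandtRankOne` follows. -/
theorem brandtRankOneCoprime_of (h6 : TraceIdentityOfTraceFormulaCoprime)
    (hTF : ∀ (N : ℕ) [NeZero N], HeckeTraceFormulaGL2Level N 1 2) : BrandtRankOneCoprime :=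
  brandtRankOneCoprime_iff_at_true.mpr (brandtRankOneAt_of_traceIdentityAt (h6 hTF))


end Summit.ABC.ABC.Cruxes.DefiniteRTControlPrime.StubIdeas3G21

end
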